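import Mathlib
import Literature.NumberTheory.DiophantineGeometry.AbcWave0
import Literature.NumberTheory.DiophantineGeometry.AbcWave0MihailescuProofs

/-!
# The one-slot square rung of the three-slot cyclotomic descent (BC5 witness)

On the shape `1 + 2^x · q^y = r²` with `q, r` prime and `y ≥ 1` (the `z = 2`, `p = 2` member of the
one-slot shape `1 + p^x q^y = r^z` of the cell `ω(abc) ≤ 3`; champions `25 = 1 + 2³·3`,
`49 = 1 + 2⁴·3`, `289 = 1 + 2⁵·3²`, quality `1.2252`) the abc inequality holds with `ε = 0` and
`C = 5`:  `r² ≤ 5 · rad(2^x q^y r²)`.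

Proof: `(r-1)(r+1) = 2^x q^y` with `gcd(r-1, r+1) = 2` forces `q^y = 2^(x-2) ± 1` and
`r = 2 q^y ± 1`; Mihăilescu's theorem (`mihailescu_holds`, proved in the tree after Schoof) leaves
`y = 1` or `(q, y, x, r) = (3, 2, 5, 17)`; in both cases `r ≤ 10 q`, while `2 · q · r ∣ rad`.
The degenerate parameters `x = 0` and `q = 2` are settled by the same theorem (`c ∈ {4, 9}`).
-/

namespace Summit.ABC.ABC.Theorems.ThreeSlotZooSquareRung

open Literature.NumberTheory.DiophantineGeometry UniqueFactorizationMonoid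

/-- `q ^ y ≥ 4` for `q, y ≥ 2`. -/
theorem four_le_pow {q y : ℕ} (hq : 2 ≤ q) (hy : 2 ≤ y) : 4 ≤ q ^ y :=
  calc 4 = 2 ^ 2 := by norm_num
    _ ≤ 2 ^ y := Nat.pow_le_pow_right (by norm_num) hy
    _ ≤ q ^ y := Nat.pow_le_pow_left hq y

/-- Catalan-lite A: `q ^ y + 1` is not a power of two when `q, y ≥ 2` (from Mihăilescu). -/
theorem pow_add_one_ne_two_pow {q y m : ℕ} (hq : 2 ≤ q) (hy : 2 ≤ y) (h : 2 ^ m = q ^ y + 1) :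
    False := by
  have h4 := four_le_pow hq hy
  have hm : 2 ≤ m := by
    by_contra hm
    push Not at hm
    interval_cases m <;> simp at h <;> omega
  obtain ⟨h3, -, -, -⟩ := mihailescu_holds (x := 2) (y := q) (a := m) (b := y) (by omega) hm hy h
  omega

/-- Catalan-lite B: `q ^ y = 2 ^ m + 1` with `q, y ≥ 2` forces `3² = 2³ + 1` (from Mihăilescu). -/
theorem pow_eq_two_pow_add_one {q y m : ℕ} (hq : 2 ≤ q) (hy : 2 ≤ y) (h : q ^ y = 2 ^ m + 1) :
    q = 3 ∧ y = 2 ∧ m = 3 := by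
  have h4 := four_le_pow hq hy
  have hm : 2 ≤ m := by
    by_contra hm
    push Not at hm
    interval_cases m <;> simp at h <;> omega
  obtain ⟨h3, h2, -, hb⟩ := mihailescu_holds (x := q) (y := 2) (a := y) (b := m) (by omega) hy hm h
  exact ⟨h3, h2, hb⟩

/-- The structural core: for `q` an odd prime, `x ≥ 1`, `y ≥ 1` and `1 + 2^x q^y = r²` with `r` prime,
`r ≤ 10 q` (in fact `r = 2q ± 1`, or `r = 17, q = 3`). -/
theorem core {x y q r : ℕ} (hq : q.Prime) (hr : r.Prime) (hq2 : q ≠ 2) (hx : 1 ≤ x) (hy : 1 ≤ y)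
    (h : 1 + 2 ^ x * q ^ y = r ^ 2) : r ≤ 10 * q := by
  have hq3 : 3 ≤ q := by
    rcases hq.eq_two_or_odd' with h2 | hodd
    · exact absurd h2 hq2
    · have := hq.two_le; rcases hodd with ⟨k, hk⟩; omega
  have hqpos : 0 < q ^ y := pow_pos hq.pos y
  have hqy3 : 3 ≤ q ^ y := by
    calc 3 ≤ q := hq3
      _ = q ^ 1 := (pow_one q).symm
      _ ≤ q ^ y := Nat.pow_le_pow_right hq.pos hy
  -- r is odd
  have hr2 : r ≠ 2 := by
    rintro rfl
    have h3 : 2 ^ x * q ^ y = 3 := by omega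
    have h2 : 2 ∣ 2 ^ x * q ^ y := dvd_mul_of_dvd_left (dvd_pow_self 2 (by omega)) _
    omega
  have hrodd : Odd r := hr.eq_two_or_odd'.resolve_left hr2
  obtain ⟨k, hk⟩ := hrodd
  have hr3 : 3 ≤ r := by have := hr.two_le; omega
  have hk1 : 1 ≤ k := by omega
  -- 2^x q^y = 4 k (k+1)
  have hprod0 : 2 ^ x * q ^ y = 4 * (k * (k + 1)) := by
    subst hk; ring_nf; ring_nf at h; omega
  -- x ≥ 2
  have hx2 : 2 ≤ x := by
    by_contra hx2
    have hx1 : x = 1 := by omega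
    subst hx1
    have hqy : q ^ y = 2 * (k * (k + 1)) := by omega
    have h2 : 2 ∣ q ^ y := ⟨_, hqy⟩
    have h2q := Nat.prime_two.dvd_of_dvd_pow h2
    have := (Nat.prime_dvd_prime_iff_eq Nat.prime_two hq).mp h2q
    exact hq2 this.symm
  obtain ⟨a, rfl⟩ : ∃ a, x = a + 2 := ⟨x - 2, by omega⟩
  have hprod : k * (k + 1) = 2 ^ a * q ^ y := by
    have h4 : 4 * (2 ^ a * q ^ y) = 4 * (k * (k + 1)) := by rw [← hprod0]; ring
    omega
  have hqy_dvd : q ^ y ∣ k * (k + 1) := ⟨2 ^ a, by rw [hprod]; ring⟩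
  by_cases hqk1 : q ∣ k + 1
  · -- Case B: q ∤ k, so q^y ∣ k + 1, k + 1 = q^y, k = 2^a
    have hqk : ¬ q ∣ k := by
      intro hqk
      have h1 : q ∣ 1 := (Nat.dvd_add_right hqk).mp hqk1
      exact hq.one_lt.ne' (Nat.dvd_one.mp h1)
    have hcopB : Nat.Coprime (q ^ y) k := (hq.coprime_iff_not_dvd.mpr hqk).pow_left y
    obtain ⟨t, ht⟩ : q ^ y ∣ k + 1 := hcopB.dvd_of_dvd_mul_left hqy_dvd
    have hkt : k * t = 2 ^ a := by
      have h1 : q ^ y * (k * t) = q ^ y * 2 ^ a := by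
        calc q ^ y * (k * t) = k * (q ^ y * t) := by ring
          _ = k * (k + 1) := by rw [ht]
          _ = 2 ^ a * q ^ y := hprod
          _ = q ^ y * 2 ^ a := by ring
      exact Nat.eq_of_mul_eq_mul_left hqpos h1
    obtain ⟨i, -, hki⟩ := (Nat.dvd_prime_pow Nat.prime_two).mp (⟨t, hkt.symm⟩ : k ∣ 2 ^ a)
    obtain ⟨j, -, htj⟩ := (Nat.dvd_prime_pow Nat.prime_two).mp (⟨k, by rw [← hkt]; ring⟩ : t ∣ 2 ^ a)
    -- t = 1
    have ht1 : t = 1 := by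
      rcases j with _ | j
      · simpa using htj
      · exfalso
        have h2t : 2 ∣ t := by rw [htj]; exact dvd_pow_self 2 (by omega)
        rcases i with _ | i
        · -- k = 1: then 2 = q^y * t, impossible
          have hk1' : k = 1 := by simpa using hki
          rw [hk1'] at ht
          have : q ^ y ∣ 2 := ⟨t, ht⟩
          have := Nat.le_of_dvd (by norm_num) this
          omega
        · have h2k : 2 ∣ k := by rw [hki]; exact dvd_pow_self 2 (by omega)
          have h2k1 : 2 ∣ k + 1 := by rw [ht]; exact dvd_mul_of_dvd_right h2t _
          omega
    rw [ht1, mul_one] at ht hkt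
    -- now k + 1 = q ^ y and k = 2 ^ a
    rcases Nat.lt_or_ge y 2 with hy1 | hy2
    · have hy1' : y = 1 := by omega
      rw [hy1', pow_one] at ht
      omega
    · obtain ⟨hq3', hy2', ha3⟩ := pow_eq_two_pow_add_one hq.two_le hy2 (by rw [← ht, hkt])
      subst hq3' ha3
      omega
  · -- Case A: q^y ∣ k, k = q^y, k + 1 = 2^a
    have hcopA : Nat.Coprime (q ^ y) (k + 1) := (hq.coprime_iff_not_dvd.mpr hqk1).pow_left y
    obtain ⟨t, ht⟩ : q ^ y ∣ k := hcopA.dvd_of_dvd_mul_right hqy_dvd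
    have hkt : (k + 1) * t = 2 ^ a := by
      have h1 : q ^ y * ((k + 1) * t) = q ^ y * 2 ^ a := by
        calc q ^ y * ((k + 1) * t) = (q ^ y * t) * (k + 1) := by ring
          _ = k * (k + 1) := by rw [ht]
          _ = 2 ^ a * q ^ y := hprod
          _ = q ^ y * 2 ^ a := by ring
      exact Nat.eq_of_mul_eq_mul_left hqpos h1
    obtain ⟨i, -, hki⟩ := (Nat.dvd_prime_pow Nat.prime_two).mp (⟨t, hkt.symm⟩ : k + 1 ∣ 2 ^ a)
    obtain ⟨j, -, htj⟩ := (Nat.dvd_prime_pow Nat.prime_two).mp (⟨k + 1, by rw [← hkt]; ring⟩ : t ∣ 2 ^ a)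
    have ht1 : t = 1 := by
      rcases j with _ | j
      · simpa using htj
      · exfalso
        have h2t : 2 ∣ t := by rw [htj]; exact dvd_pow_self 2 (by omega)
        rcases i with _ | i
        · simp at hki; omega
        · have h2k1 : 2 ∣ k + 1 := by rw [hki]; exact dvd_pow_self 2 (by omega)
          have h2k : 2 ∣ k := by rw [ht]; exact dvd_mul_of_dvd_right h2t _
          omega
    rw [ht1, mul_one] at ht hkt
    -- now k = q ^ y and k + 1 = 2 ^ a
    rcases Nat.lt_or_ge y 2 with hy1 | hy2
    · have hy1' : y = 1 := by omega
      rw [hy1', pow_one] at ht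
      omega
    · exact (pow_add_one_ne_two_pow hq.two_le hy2 (m := a) (by rw [← hkt, ht])).elim

/-- **The rung** (matches `stub_rung_zooSquare` of the birth skeleton of crux `CyclotomicZooABC`,
route-ABC-ThreeSlotCyclotomicDescent): ε-free abc with constant `5` on the one-slot square shape. -/
theorem zooSquareRung : ∀ x y q r : ℕ, q.Prime → r.Prime → 1 ≤ y → 1 + 2 ^ x * q ^ y = r ^ 2 →
    r ^ 2 ≤ 5 * rad 1 (2 ^ x * q ^ y) (r ^ 2) := by
  intro x y q r hq hr hy h
  have hq0 := hq.pos
  have hr0 := hr.pos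
  have hn0 : 1 * (2 ^ x * q ^ y) * r ^ 2 ≠ 0 := by positivity
  have hradpos : 0 < rad 1 (2 ^ x * q ^ y) (r ^ 2) := by
    rw [rad_def]; exact Nat.pos_of_ne_zero radical_ne_zero
  have h2n : 2 ≤ x + 0 → 2 ∣ 1 * (2 ^ x * q ^ y) * r ^ 2 := fun _ => by
    exact Dvd.dvd.mul_right (Dvd.dvd.mul_left (dvd_mul_of_dvd_left (dvd_pow_self 2 (by omega)) _) _) _
  by_cases hq2 : q = 2
  · -- q = 2: r² = 2^(x+y) + 1, so (Mihăilescu) r = 3, x + y = 3, and rad ≥ 2 suffices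
    subst hq2
    have h' : r ^ 2 = 2 ^ (x + y) + 1 := by rw [pow_add]; omega
    have hxy : 2 ≤ x + y := by
      by_contra hxy
      have : x + y = 1 := by omega
      rw [this] at h'
      have hr3 : r ^ 2 = 3 := by simpa using h'
      have hr2 := hr.two_le
      nlinarith
    obtain ⟨hr3, -, -, -⟩ := mihailescu_holds (x := r) (y := 2) (a := 2) (b := x + y) (by norm_num) le_rfl hxy h'
    subst hr3
    have h2 : 2 ∣ rad 1 (2 ^ x * 2 ^ y) (3 ^ 2) := by
      rw [rad_def]
      refine (dvd_radical_iff_of_irreducible Nat.prime_two hn0).mpr ?_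
      rw [← pow_add]
      exact Dvd.dvd.mul_right (Dvd.dvd.mul_left (dvd_pow_self 2 (by omega)) _) _
    have := Nat.le_of_dvd hradpos h2
    omega
  by_cases hx : x = 0
  · -- x = 0: r² = q^y + 1: (Mihăilescu) r = 3, q = 2 (excluded) unless y = 1; y = 1: q = r² - 1 prime ⇒ r = 2
    subst hx
    have h' : r ^ 2 = q ^ y + 1 := by simp at h; omega
    rcases Nat.lt_or_ge y 2 with hy1 | hy2
    · have hy1' : y = 1 := by omega
      subst hy1'
      -- q = r² - 1 = (r - 1)(r + 1) prime ⇒ r - 1 = 1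
      have hr2 : 2 ≤ r := hr.two_le
      have hfac : q = (r - 1) * (r + 1) := by
        have : r ^ 2 = (r - 1) * (r + 1) + 1 := by
          cases r with
          | zero => omega
          | succ n => simp; ring
        rw [pow_one] at h'; omega
      have hunit := (Nat.prime_mul_iff.mp (hfac ▸ hq))
      have hr1 : r - 1 = 1 := by
        rcases hunit with ⟨-, h1⟩ | ⟨-, h1⟩
        · omega
        · omega
      have hr2' : r = 2 := by omega
      subst hr2'
      have : 4 ≤ 5 * rad 1 (2 ^ 0 * q ^ 1) (2 ^ 2) := by omega
      simpa using this
    · obtain ⟨-, -, hq2', -⟩ := mihailescu_holds (x := r) (y := q) (a := 2) (b := y) hq.pos le_rfl hy2 h'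
      exact absurd hq2' hq2
  -- main case: q odd prime, x ≥ 1
  have hx1 : 1 ≤ x := by omega
  have hcore := core hq hr hq2 hx1 hy h
  -- 2 · q · r ∣ rad
  have hqr : q ≠ r := by
    rintro rfl
    have hdq : q ∣ 2 ^ x * q ^ y := dvd_mul_of_dvd_right (dvd_pow_self q (by omega)) _
    have hdq2 : q ∣ q ^ 2 := dvd_pow_self q (by norm_num)
    have h1 : q ∣ 2 ^ x * q ^ y + 1 := by rw [add_comm, h]; exact hdq2
    have : q ∣ 1 := (Nat.dvd_add_right hdq).mp h1
    exact hq.one_lt.ne' (Nat.dvd_one.mp this)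
  have hr2 : r ≠ 2 := by
    rintro rfl
    have h3 : 2 ^ x * q ^ y = 3 := by omega
    have h2 : 2 ∣ 2 ^ x * q ^ y := dvd_mul_of_dvd_left (dvd_pow_self 2 (by omega)) _
    omega
  have hd2 : 2 ∣ rad 1 (2 ^ x * q ^ y) (r ^ 2) := by
    rw [rad_def]
    exact (dvd_radical_iff_of_irreducible Nat.prime_two hn0).mpr
      (Dvd.dvd.mul_right (Dvd.dvd.mul_left (dvd_mul_of_dvd_left (dvd_pow_self 2 (by omega)) _) _) _)
  have hdq : q ∣ rad 1 (2 ^ x * q ^ y) (r ^ 2) := by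
    rw [rad_def]
    exact (dvd_radical_iff_of_irreducible hq hn0).mpr
      (Dvd.dvd.mul_right (Dvd.dvd.mul_left (dvd_mul_of_dvd_right (dvd_pow_self q (by omega)) _) _) _)
  have hdr : r ∣ rad 1 (2 ^ x * q ^ y) (r ^ 2) := by
    rw [rad_def]
    exact (dvd_radical_iff_of_irreducible hr hn0).mpr (Dvd.dvd.mul_left (dvd_pow_self r (by norm_num)) _)
  have hc2q : Nat.Coprime 2 q := (Nat.coprime_primes Nat.prime_two hq).mpr (Ne.symm hq2)
  have hc2r : Nat.Coprime 2 r := (Nat.coprime_primes Nat.prime_two hr).mpr (Ne.symm hr2)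
  have hcqr : Nat.Coprime q r := (Nat.coprime_primes hq hr).mpr hqr
  have h2q : 2 * q ∣ rad 1 (2 ^ x * q ^ y) (r ^ 2) := hc2q.mul_dvd_of_dvd_of_dvd hd2 hdq
  have h2qr : 2 * q * r ∣ rad 1 (2 ^ x * q ^ y) (r ^ 2) :=
    (Nat.Coprime.mul_left hc2r hcqr).mul_dvd_of_dvd_of_dvd h2q hdr
  have hle := Nat.le_of_dvd hradpos h2qr
  calc r ^ 2 = r * r := sq r
    _ ≤ (10 * q) * r := Nat.mul_le_mul_right r hcore
    _ = 5 * (2 * q * r) := by ring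
    _ ≤ 5 * rad 1 (2 ^ x * q ^ y) (r ^ 2) := Nat.mul_le_mul_left 5 hle

end Summit.ABC.ABC.Theorems.ThreeSlotZooSquareRung
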